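import Literature.AlgebraicGeometry.Resolution.InseparableLocalUniformizationEngine
import Literature.AlgebraicGeometry.Resolution.InseparableLocalUniformizationHeightBricks
import Literature.AlgebraicGeometry.Resolution.InseparableLocalUniformizationHeightValuations
import Literature.AlgebraicGeometry.Resolution.InseparableLocalUniformizationAlgebra
import Literature.AlgebraicGeometry.Resolution.InseparableLocalUniformizationProofs
import Literature.AlgebraicGeometry.Resolution.TranscendentallyImmediate
import Mathlib.Algebra.CharP.Reduced
import HarnessLib

/-!
# Inseparable local uniformization: Steps 0–2 of the proof of Thm. 4.1.1, and the induction step assembled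

Topic: `Literature/AlgebraicGeometry/Resolution`. M. Temkin, *Inseparable local uniformization*,
J. Algebra 373 (2013) 65–119 = arXiv:0804.1554v3 (numbering and pages of this version; in the
41-pp. arXiv version held in the literature store the proof of Thm. 4.1.1 is on pp. 29–30, with
Thm. 3.3.1 = "Theorem (dim1unif)", Lemma 2.8.4 = 2.7.4, Lemma 2.8.5 = 2.7.5, and
"transcendentally immediate" called "essentially immediate").

The named fact `Temkin2013DescentDefectStep` (`InseparableLocalUniformizationDefect.lean`) is the
induction step of the proof of Thm. 4.1.1 (`n = 1`, non-logarithmic form): the descent theorem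
for valued fields of transcendence defect `≤ d` implies it for transcendence defect `≤ d + 1`
(proof of Thm. 4.1.1, Steps 0–4, pp. 47–50). Its two deep inputs are already vendored as named
facts, in the affine vocabulary of the companion files:

* `Temkin2013RelativeCurve` — Thm. 3.3.1 (`n = 1`): inseparable local uniformization of a
  transcendentally immediate valued field `K` of transcendence degree one over a valued field
  `k̄` of height one (`InseparableLocalUniformizationCurves.lean`; Berkovich-analytic);
* `Temkin2013_Steps34` — Steps 3–4 of the proof (`InseparableLocalUniformizationEngine.lean`;
  Lemmas 2.8.4/2.8.5, Prop. 2.3.8, descent of smoothness), with "Thm. 4.1.1 applies to `Y`" as a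
  hypothesis.

This file PROVES the rest of the printed argument — Steps 0, 1 and 2 — and assembles:

* `Temkin2013DescentDefectStep.of_relativeCurve_of_steps34 :
    Temkin2013RelativeCurve → Temkin2013_Steps34 → Temkin2013DescentDefectStep`.

The proof follows the text (p. 47–48). Given `K/k` finitely generated, `K° = O ⊇ k` of height
`≤ 1` with `D_{K/k} ≤ d + 1`, a normal affine model `X = Spec A` and a finite valued extension
`(K₁, K₁°)`: if `D ≤ d` the induction hypothesis applies, and height `0` is
`temkin2013DescentFor_top`; so `D = d + 1 > 0` and `K°` has height one.
*Step 1*: `exists_intermediateField_trdeg_eq_one_isTranscendentallyImmediateOver`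
(`TranscendentallyImmediate.lean`, Remark 2.1.2) gives `k̄ ⊆ K`, finitely generated over `k`, with
`tr.deg._{k̄}(K) = 1`, `K/k̄` transcendentally immediate and `D_{k̄/k} = d`; `k̄° = K° ∩ k̄` has
height exactly one (`ringKrullDim_comap_eq_one_of_isValueTorsionOver`: at most one because the
overrings of `k̄°` embed into those of `K°`, not zero because `|K^×|/|k̄^×|` is torsion);
`C = Nr_K(X ×_Y S) = etaModel k̄ (Nr_K A) k̄°` is an affine normalized `S`-model of `K°`
(`isAffineNormalizedModel_etaModel`), and Thm. 3.3.1 applies to `C`, `K₁/K` and `S = Spec k̄°`: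
we get `C' = Spec A' ⊇ C` with `A' = Nr_K(k̄°[f₁, …, f_n])`, `l/k̄` finite purely inseparable,
`L₁ = lK₁` with `L₁° = O₁'`, `m/l` finite with `m°`, and the smooth-equivalence over `k̄°` of the
centre `z₁` of `L₁°` on `Nr_{L₁}(C')` with the closed point of `Spec m°`.
*Step 2*: "we can use `fᵢ`'s to define an affine refinement `X′ → X` such that
`C′ = Nr_K(X′ ×_Y S)`": `X″ = Nr_K(A[f, c])`, where we also adjoin finitely many elements `c_j` of
`k̄°` — `q`-power norms of generators of an affine model `B'` of `l°` — which does not change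
`Nr_K(X″ ×_Y S)` ("refining `Y`", cf. Step 3) but makes `B'` land in `Nr_L(X″)`; "we extend the
field `K` by replacing it with `L := lK`. Then `X` is replaced with `X_L := Nr_L(X)` and we can
just replace `Y` and `C` with `Y_l := Nr_l(Y)` and `Nr_L(X_l ×_{Y_l} S_l) →~ Nr_L(C)`": with
`L = K(l) ⊆ L₁` (purely inseparable over `K`), `L° = L₁° ∩ L`, the copy `l' ⊆ L` of `l`, its
valuation ring `l'° = L° ∩ l'` (height one, `ringKrullDim_eq_comap_of_isPurelyInseparable`; and
`D_{l'/k} ≤ D_{k̄/k} = d`, `transcendenceDefect_le_of_isAlgebraic`, so that THE INDUCTION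
HYPOTHESIS gives "Thm. 4.1.1 applies to `Y`, `l'°`"), and `A_L = Nr_L(X″)`
(`exists_normalisation_in_extension`, E. Noether), one checks
`Nr_{L₁}(A_L · l'°) = Nr_{L₁}(C') = N` (`etaModel l' (Nr A_L) l'° = N`), and the
smooth-equivalence over `k̄°` given by Thm. 3.3.1 is one over `l'°`
(`AreSmoothEquivalent.of_comp_of_forall_pow_mem`: the two `l'°`-structures of the common smooth
cover `Z` agree, since they agree on `k̄°`, every element of `l'°` has a `qⁿ`-th power in `k̄°`,
and `Z` — smooth over the integral `Nr_{L₁}(C')` — is reduced, `isReduced_of_smooth_of_isDomain`,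
so that `qⁿ`-th roots in `O(Z)` are unique; this is the tacit point behind diagram (2), p. 48).
*Steps 3–4*: `Temkin2013_Steps34` for `(k, L, L°, l', B', A_L, L₁, L₁°, m, m°)` yields the descent
conclusion for `(L, Nr_L(X″), L₁)`; *Step 0* (`Temkin2013DescentConclusion.of_purelyInseparable`,
`.of_le`, `InseparableLocalUniformizationDescentStepZero.lean`) transports it back to
`(K, X″, K₁)` and then to `X`.

Also PROVED here, as bricks: `one_le_ringKrullDim_of_ne_top` (a valuation ring `≠ K` has
positive height), `IsAffineNormalizedModel.of_le`, `areSmoothEquivalent_congr_of_eq`,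
`intermediateField_fg_top_of_finiteDimensional`, `isIntegral_map_of_map_le`.

Corollaries: `Temkin2013Descent.of_relativeCurve_of_steps34`,
`Temkin2013Relative.of_curve_frontier`, `Temkin2013.of_curve_frontier` — the frontier of the
corrected Thm. 1.3.2 becomes `{Temkin2013DescentAbhyankar (Thm. 5.5.2 (i)),
Temkin2013RelativeCurve (Thm. 3.3.1), Temkin2013_Steps34 (Steps 3–4 of Thm. 4.1.1),
Temkin2013HeightStepOfDescent (§4.2)}`.

## STATUS (verdict clean-up, 2026-08-16): `Temkin2013_Steps34` is deprecated

The named fact `Temkin2013_Steps34` taken by the assembly and the corollaries of this file is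
MIS-RENDERED (its binders `[Algebra k̄ K₁] [IsScalarTower k̄ K K₁]` leave the `k̄`-structure of
`K₁` arbitrary, the tower hypothesis being the automatic one for the action inherited from `K`)
and is DEPRECATED in `InseparableLocalUniformizationEngine.lean` (statement kept verbatim). Its
corrected rendering `Temkin2013_Steps34_tower` (`InseparableLocalUniformizationEngineTower.lean`)
is PROVED (`Temkin2013_Steps34_tower_holds`, `…StepsThreeFourHolds.lean`). The proof below only
ever instantiates the arbitrary structure with the inherited one, and it has been re-run on the
corrected fact in `InseparableLocalUniformizationDefectStepTower.lean`
(`Temkin2013DescentDefectStep.of_relativeCurve_of_steps34_tower`, with the corollaries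
`Temkin2013Descent.of_relativeCurve_of_steps34_tower`, `Temkin2013HeightLeOne.of_curve_frontier_tower`,
`Temkin2013Descent.of_frontier₃_tower`, …), made free of this hypothesis in
`…StepsThreeFourHolds.lean` (`Temkin2013Descent.of_abhyankar_smoothFibre`) and
`…DefectStepFrontier.lean` (`Temkin2013DescentDefectStep.of_smoothFibre`). The five declarations
of this file naming `Temkin2013_Steps34` are kept under their ledger-referenced names as a legacy
layer, each switching `linter.deprecated` off for itself alone; the bricks and Steps 0–2 proved
here are unaffected and remain in use (imported by `…DefectStepTower.lean`).

## Sources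

* M. Temkin, *Inseparable local uniformization*, J. Algebra 373 (2013) 65–119 =
  arXiv:0804.1554v3: proof of Thm. 4.1.1, Steps 0–4 (pp. 47–50); Thm. 3.3.1 (p. 44);
  Remark 2.1.2 (p. 10); Definition 2.8.1 and Lemma 2.8.5 (pp. 29–31).

## Rendering notes

* As in the companion files: `k` trivially valued ↦ `hk : ∀ c, algebraMap k K c ∈ O`; height
  `≤ 1` ↦ `ringKrullDim O ≤ 1`; `D_{K/k}` ↦ `transcendenceDefect k O hk`; affine models are
  finitely generated `k`-subalgebras of the field with the right fraction field; `Nr` ↦ `nrIn`;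
  `Nr_K(X ×_Y S)` ↦ `etaModel`.
* The field `L = lK` of Step 2 is the intermediate field `IntermediateField.adjoin K l` of
  `L₁/K`, and the new base field is the copy `l' = {x ∈ L | x ∈ l}` of `l` inside `L` (an
  `IntermediateField k L`, as `Temkin2013_Steps34` requires), identified with `l` by
  `x ↦ x`; `m` becomes an `l'`-algebra through this identification.
-/

noncomputable section

open IsLocalRing Cardinal

namespace Literature.AlgebraicGeometry.Resolution

universe u

/-! ### Bricks -/

section bricks

/-- Two ring homomorphisms out of `R₁` into a reduced ring of exponential characteristic `q`
which agree on a subring `R₀ → R₁` over which every element of `R₁` has a `qⁿ`-th power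
coincide (`qⁿ`-th roots are unique in a reduced ring: `iterateFrobenius_inj`). This is the
ring version of Mathlib's `IsPurelyInseparable.injective_comp_algebraMap`. [folklore] -/
theorem ringHom_eq_of_comp_eq_of_forall_pow_mem {R₀ R₁ D : Type*} [CommRing R₀] [CommRing R₁]
    [CommRing D] [IsReduced D] (q : ℕ) [ExpChar D q] (φ : R₀ →+* R₁)
    (hφ : ∀ x : R₁, ∃ n : ℕ, x ^ q ^ n ∈ φ.range) {f g : R₁ →+* D}
    (h : f.comp φ = g.comp φ) : f = g := by
  refine RingHom.ext fun x => ?_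
  obtain ⟨n, y, hy⟩ := hφ x
  have key : f (φ y) = g (φ y) := by
    have := congrArg (fun ψ : R₀ →+* D => ψ y) h
    simpa only [RingHom.comp_apply] using this
  rw [hy, map_pow, map_pow] at key
  exact iterateFrobenius_inj D q n (by simpa only [iterateFrobenius_def] using key)

/-- **Smooth-equivalence over `S` is smooth-equivalence over a radicial `S' → S`** (the point
tacitly used in Step 2 of the proof of Temkin's Thm. 4.1.1, p. 48, when the base `S = Spec k̄°`
is replaced by `S_l = Spec l°` for a purely inseparable `l/k̄`, and in Step 4, p. 49, via
Lemma 2.8.5): let `φ : R₀ → R₁` be such that every element of `R₁` has a `qⁿ`-th power in the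
image (`q` the exponential characteristic of a field `F` mapping to the domain `A`), and let
`f : R₁ → A`, `g : R₁ → B` be structure maps. If `(Spec A, p)` and `(Spec B, P)` are
smooth-equivalent over `R₀` (for `f ∘ φ`, `g ∘ φ`), they are smooth-equivalent over `R₁`: the
common smooth cover `Z = Spec D` is reduced (`isReduced_of_smooth_of_isDomain`, Lemma 2.3.9 (i))
of exponential characteristic `q`, so its two `R₁`-structures, which agree on `R₀`, coincide
(`ringHom_eq_of_comp_eq_of_forall_pow_mem`). PROVED.
[cite: Temkin2013, proof of Thm. 4.1.1, Steps 2 and 4 (pp. 48–49)] -/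
theorem AreSmoothEquivalent.of_comp_of_forall_pow_mem {F R₀ R₁ A B : Type u} [Field F]
    [CommRing R₀] [CommRing R₁] [CommRing A] [CommRing B] [IsDomain A] (q : ℕ) [ExpChar F q]
    (i : F →+* A) (φ : R₀ →+* R₁) (hφ : ∀ x : R₁, ∃ n : ℕ, x ^ q ^ n ∈ φ.range)
    (f : R₁ →+* A) (g : R₁ →+* B) {p : Ideal A} {P : Ideal B}
    (h : AreSmoothEquivalent (f.comp φ) (g.comp φ) p P) : AreSmoothEquivalent f g p P := by
  obtain ⟨D, _, _, _, hcomp, hA, hB, r, hr, hrp, hrq⟩ := h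
  haveI := hA
  haveI : IsReduced D := isReduced_of_smooth_of_isDomain A D
  haveI : Nontrivial D := by
    refine ⟨⟨0, 1, fun h01 => hr.ne_top ?_⟩⟩
    rw [Ideal.eq_top_iff_one, ← h01]
    exact r.zero_mem
  haveI : ExpChar D q := expChar_of_injective_ringHom ((algebraMap A D).comp i).injective q
  refine ⟨D, inferInstance, inferInstance, inferInstance, ?_, hA, hB, r, hr, hrp, hrq⟩
  refine ringHom_eq_of_comp_eq_of_forall_pow_mem q φ hφ ?_
  rw [RingHom.comp_assoc, RingHom.comp_assoc]
  exact hcomp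

/-- Smooth-equivalence data are invariant under rewriting the model along an equality of
subrings (with the centre of a valuation ring `O'` as the point). [folklore] -/
theorem areSmoothEquivalent_congr_of_eq {L R₀ B : Type u} [Field L] [CommRing R₀] [CommRing B]
    (O' : ValuationSubring L) {N₁ N₂ : Subring L} (h12 : N₁ = N₂)
    (h₁ : N₁ ≤ O'.toSubring) (h₂ : N₂ ≤ O'.toSubring)
    (f₁ : R₀ →+* N₁) (f₂ : R₀ →+* N₂) (hf : ∀ x, (f₁ x : L) = f₂ x) (g : R₀ →+* B)
    (P : Ideal B) :
    AreSmoothEquivalent f₁ g ((maximalIdeal O').comap (Subring.inclusion h₁)) P ↔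
      AreSmoothEquivalent f₂ g ((maximalIdeal O').comap (Subring.inclusion h₂)) P := by
  subst h12
  have : f₁ = f₂ := RingHom.ext fun x => Subtype.ext (hf x)
  subst this
  exact Iff.rfl

/-- The auxiliary valuation ring in `IsAffineNormalizedModel` only records that the generators
lie in it; any valuation ring containing the model will do. [folklore] -/
theorem IsAffineNormalizedModel.of_le {K : Type u} [Field K] {O O' : ValuationSubring K}
    {R₀ A : Subring K} (h : IsAffineNormalizedModel O' R₀ A) (hA : A ≤ O.toSubring) :
    IsAffineNormalizedModel O R₀ A := by
  obtain ⟨s, -, hA', hfr⟩ := h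
  refine ⟨s, fun x hx => hA ?_, hA', hfr⟩
  have hx' : x ∈ Subring.closure ((R₀ : Set K) ∪ ↑s) := Subring.subset_closure (Or.inr hx)
  rw [← SetLike.mem_coe, hA']
  exact isIntegral_algebraMap (x := (⟨x, hx'⟩ : Subring.closure ((R₀ : Set K) ∪ ↑s)))

/-- Integrality is transported along a ring homomorphism mapping one subring into another.
[folklore] -/
theorem isIntegral_map_of_map_le {R S : Type*} [CommRing R] [CommRing S] (f : R →+* S)
    {T : Subring R} {T' : Subring S} (h : T.map f ≤ T') {x : R} (hx : IsIntegral T x) :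
    IsIntegral T' (f x) :=
  hx.map_of_comp_eq ((f.comp T.subtype).codRestrict T' fun t => h ⟨t, t.2, rfl⟩) f
    (RingHom.ext fun _ => rfl)

/-- **A valuation ring which is not the whole field has positive height**: its maximal ideal is
a non-zero prime. [folklore] -/
theorem one_le_ringKrullDim_of_ne_top {K : Type u} [Field K] (O : ValuationSubring K)
    (hO : O ≠ ⊤) : 1 ≤ ringKrullDim O := by
  have hbot : (⊥ : Ideal O) ≠ maximalIdeal O := by
    intro hb
    apply hO
    rw [eq_top_iff]
    intro z _
    by_contra hz
    have hzi : z⁻¹ ∈ O := (O.mem_or_inv_mem z).resolve_left hz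
    have hz0 : z ≠ 0 := by rintro rfl; exact hz O.zero_mem
    have hunit : ¬ IsUnit (⟨z⁻¹, hzi⟩ : O) := by
      intro hu
      apply hz
      have := inv_mem_of_isUnit O hzi hu
      rw [inv_inv] at this
      exact this
    have hmem : (⟨z⁻¹, hzi⟩ : O) ∈ maximalIdeal O := (IsLocalRing.mem_maximalIdeal _).mpr hunit
    rw [← hb] at hmem
    have : (z⁻¹ : K) = 0 := congrArg Subtype.val (Ideal.mem_bot.mp hmem)
    exact inv_ne_zero hz0 this
  haveI : (⊥ : Ideal O).IsPrime := Ideal.isPrime_bot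
  have hlt : (⟨⊥, inferInstance⟩ : PrimeSpectrum O) < ⟨maximalIdeal O, inferInstance⟩ :=
    lt_of_le_of_ne bot_le (fun heq => hbot (congrArg PrimeSpectrum.asIdeal heq))
  exact Order.one_le_krullDim_iff.mpr ⟨_, _, hlt⟩

/-- **The valuation ring of the base field of the fibration has height one** (Temkin 2013,
proof of Thm. 4.1.1, Step 1, p. 47: `S = Spec(k̄°)` is a base to which Thm. 3.3.1 — about valued
fields of height one — applies): if `K° ≠ K` has height `≤ 1` and `|K^×|` is torsion over the
values of a subfield `E` (e.g. `K/E` transcendentally immediate), then `E° = K° ∩ E` has height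
exactly one: at most one since the overrings of `E°` embed into those of `K°`
(`krullDimLE_one_comap_of_immediate`), and `E° ≠ E` since an element of value `> 1` has a power
whose value is the value of an element of `E`. [cite: Temkin2013, proof of Thm. 4.1.1, Step 1 (p. 47)] -/
theorem ringKrullDim_comap_eq_one_of_isValueTorsionOver {K E : Type u} [Field K] [Field E]
    (O : ValuationSubring K) (hdim : ringKrullDim O ≤ 1) (hO : O ≠ ⊤) (g : E →+* K)
    (hvt : IsValueTorsionOver O g.fieldRange ⊤) : ringKrullDim (O.comap g) = 1 := by
  haveI : Ring.KrullDimLE 1 O := (Ring.krullDimLE_iff (R := O)).mpr (by exact_mod_cast hdim)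
  have himm : ∀ S : ValuationSubring K, O ≤ S → S ≤ ⊤ → S = O ∨ S = ⊤ := fun S h1 _ =>
    (ValuationSubring.eq_self_or_eq_top_of_le h1).imp Eq.symm id
  have hle : Ring.KrullDimLE 1 (O.comap g) :=
    krullDimLE_one_comap_of_immediate O ⊤ le_top g (fun _ => ValuationSubring.mem_top _) himm
  have hle' : ringKrullDim (O.comap g) ≤ 1 := by
    have := (Ring.krullDimLE_iff (R := O.comap g)).mp hle
    exact_mod_cast this
  have hne : O.comap g ≠ ⊤ := by
    obtain ⟨x, hxO⟩ : ∃ x : K, x ∉ O := by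
      by_contra hcon
      push Not at hcon
      exact hO (eq_top_iff.mpr fun x _ => hcon x)
    have hx0 : x ≠ 0 := fun h0 => hxO (h0 ▸ O.zero_mem)
    obtain ⟨n, hn, b, hb, hvb⟩ := hvt x (Subfield.mem_top x) hx0
    obtain ⟨z, rfl⟩ := RingHom.mem_fieldRange.mp hb
    intro htop
    have hz : z ∈ O.comap g := by rw [htop]; exact ValuationSubring.mem_top z
    have hgz : g z ∈ O := hz
    have h1 : 1 < O.valuation x := by
      rw [← not_le]
      intro hle1
      exact hxO ((O.valuation_le_one_iff x).mp hle1)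
    have h2 : 1 < O.valuation (x ^ n) := by
      rw [map_pow]
      exact one_lt_pow₀ h1 hn
    rw [hvb] at h2
    exact (not_le.mpr h2) ((O.valuation_le_one_iff _).mpr hgz)
  exact le_antisymm hle' (one_le_ringKrullDim_of_ne_top _ hne)

/-- The field range of the inclusion of an intermediate field is the intermediate field.
[folklore] -/
theorem fieldRange_algebraMap_eq_toSubfield {k K : Type u} [Field k] [Field K] [Algebra k K]
    (kb : IntermediateField k K) : (algebraMap kb K).fieldRange = kb.toSubfield := by
  ext x
  constructor
  · rintro ⟨c, rfl⟩; exact c.2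
  · intro hx; exact ⟨⟨x, hx⟩, rfl⟩

/-- A finite extension of a finitely generated extension is finitely generated (over the
bottom field). [folklore] -/
theorem intermediateField_fg_top_of_finiteDimensional {k F L : Type u} [Field k] [Field F]
    [Field L] [Algebra k F] [Algebra F L] [Algebra k L] [IsScalarTower k F L]
    [FiniteDimensional F L] (hfg : (⊤ : IntermediateField k F).FG) :
    (⊤ : IntermediateField k L).FG := by
  haveI : Algebra.EssFiniteType k F := IntermediateField.fg_top_iff.mp hfg
  haveI : Algebra.EssFiniteType F L := inferInstance
  exact IntermediateField.fg_top_iff.mpr (Algebra.EssFiniteType.comp k F L)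

/-- **The transcendence defect does not increase in an algebraic extension of the valued
field** (over a fixed trivially valued `k`): for `L/F` algebraic, `tr.deg._k(L) = tr.deg._k(F)`
while `E` and `F` can only grow (`ratRank_comap_le`, `residueTrdeg_comap_le`), so
`D_{L/k} ≤ D_{F/k}` (in fact equality holds for finite `L/F`; only this half is needed to feed
the induction hypothesis of Thm. 4.1.1 to `l ⊇ k̄`, Step 4, p. 49: "Since `D_{k̄/k} = D - 1`,
the induction assumption applies"). [cite: Temkin2013, Section 2.1 (p. 10) and proof of Thm. 4.1.1, Step 4 (p. 49)] -/
theorem transcendenceDefect_le_of_isAlgebraic {k F L : Type u} [Field k] [Field F] [Field L]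
    [Algebra k F] [Algebra F L] [Algebra k L] [IsScalarTower k F L] [Algebra.IsAlgebraic F L]
    (OL : ValuationSubring L) (OF : ValuationSubring F) (hOF : OL.comap (algebraMap F L) = OF)
    (hkL : ∀ c : k, algebraMap k L c ∈ OL) (hkF : ∀ c : k, algebraMap k F c ∈ OF)
    (hN : Algebra.trdeg k F < ℵ₀) :
    transcendenceDefect k OL hkL ≤ transcendenceDefect k OF hkF := by
  subst hOF
  have htr : Algebra.trdeg k L = Algebra.trdeg k F := by
    have h := trdeg_add_eq k F (A := L)
    rw [trdeg_eq_zero (R := F) (A := L), add_zero] at h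
    exact h.symm
  have hNL : Algebra.trdeg k L < ℵ₀ := htr ▸ hN
  have hE : ratRank (OL.comap (algebraMap F L)) ≤ ratRank OL := ratRank_comap_le OL
  have hF : residueTrdeg k (OL.comap (algebraMap F L)) hkF ≤ residueTrdeg k OL hkL :=
    residueTrdeg_comap_le k OL hkL hkF
  have hE' := Cardinal.toNat_le_toNat hE (ratRank_lt_aleph0 OL hkL hNL)
  have hF' := Cardinal.toNat_le_toNat hF (residueTrdeg_lt_aleph0 OL hkL hNL)
  unfold transcendenceDefect
  rw [htr]
  omega

/-- **Normalisation of an affine model in a finite extension** (E. Noether's finiteness of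
integral closure, `NoetherFiniteIntegralClosure_holds`; Temkin 2013, p. 4: "`Nr_L(Spec A)` is
the scheme `Spec(Nr_L(A))`", an affine variety): for an affine model `A` (finitely generated over
`k`, `Frac A = K`) and a finite extension `F/K`, the integral closure of (the image of) `A` in
`F` is a finitely generated normal `k`-subalgebra `N` of `F` with `Frac N = F`. [folklore] -/
theorem exists_normalisation_in_extension {k K : Type u} [Field k] [Field K] [Algebra k K]
    (A : Subalgebra k K) (hAfg : A.FG) (hAfr : IsFractionRing A K)
    (F : Type u) [Field F] [Algebra K F] [Algebra k F] [IsScalarTower k K F]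
    [FiniteDimensional K F] :
    ∃ N : Subalgebra k F,
      (N : Set F) = {x : F | IsIntegral (A.map (IsScalarTower.toAlgHom k K F)) x} ∧
      N.FG ∧ IsFractionRing N F ∧ (∀ x : F, IsIntegral N x → x ∈ N) := by
  classical
  haveI : IsFractionRing A K := hAfr
  haveI : Algebra.FiniteType k A := (Subalgebra.fg_iff_finiteType A).mp hAfg
  haveI hNint : Module.Finite A (integralClosure A F) := NoetherFiniteIntegralClosure_holds k A K F
  have hft : Algebra.FiniteType k (integralClosure A F) :=
    Algebra.FiniteType.trans (S := A) inferInstance inferInstance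
  let N : Subalgebra k F := (integralClosure A F).restrictScalars k
  have hmemN : ∀ x : F, x ∈ N ↔ IsIntegral A x := fun x => Iff.rfl
  -- the carrier is the integral closure of the image of `A`
  let φ : K →ₐ[k] F := IsScalarTower.toAlgHom k K F
  let e : A ≃ₐ[k] A.map φ := Subalgebra.equivMapOfInjective A φ (algebraMap K F).injective
  have hcomp : (algebraMap (A.map φ) F).comp (e : A →+* A.map φ) =
      (RingHom.id F).comp (algebraMap A F) := RingHom.ext fun _ => rfl
  have hcomp' : (algebraMap A F).comp (e.symm : A.map φ →+* A) =
      (RingHom.id F).comp (algebraMap (A.map φ) F) := by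
    refine RingHom.ext fun x => ?_
    obtain ⟨y, rfl⟩ := e.surjective x
    simp only [RingHom.coe_comp, RingHom.coe_coe, Function.comp_apply, AlgEquiv.symm_apply_apply,
      RingHom.id_apply]
    exact (congrArg (fun g : A →+* F => g y) hcomp).symm
  have hiff : ∀ x : F, IsIntegral A x ↔ IsIntegral (A.map φ) x := fun x =>
    ⟨fun hx => IsIntegral.map_of_comp_eq (e : A →+* A.map φ) (RingHom.id F) hcomp hx,
      fun hx => IsIntegral.map_of_comp_eq (e.symm : A.map φ →+* A) (RingHom.id F) hcomp' hx⟩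
  have hcarrier : (N : Set F) = {x : F | IsIntegral (A.map φ) x} := by
    ext x
    exact hiff x
  -- finite generation and fraction field
  have hNfg : N.FG := (Subalgebra.fg_iff_finiteType _).mpr hft
  have hNfr : IsFractionRing N F := by
    refine IsFractionRing.of_field N F fun z => ?_
    haveI : Algebra.IsAlgebraic K F := Algebra.IsAlgebraic.of_finite K F
    have hz : IsAlgebraic A z :=
      (IsFractionRing.isAlgebraic_iff A K F).mpr (Algebra.IsAlgebraic.isAlgebraic z)
    obtain ⟨a, ha0, hint⟩ := hz.exists_integral_multiple
    refine ⟨⟨a • z, hint⟩, ⟨algebraMap A F a, isIntegral_algebraMap⟩, ?_⟩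
    have ha' : (algebraMap A F a) ≠ 0 :=
      (map_ne_zero_iff _ (FaithfulSMul.algebraMap_injective A F)).mpr ha0
    change z = (a • z) / algebraMap A F a
    rw [Algebra.smul_def, eq_div_iff ha', mul_comm]
  -- normality
  have hAN : A.map φ ≤ N := fun x hx =>
    (hmemN x).mpr ((hiff x).mpr (isIntegral_algebraMap (x := (⟨x, hx⟩ : A.map φ))))
  have hNn : ∀ x : F, IsIntegral N x → x ∈ N := by
    intro x hx
    letI : Algebra (A.map φ) N := (Subalgebra.inclusion hAN).toRingHom.toAlgebra
    haveI : IsScalarTower (A.map φ) N F := IsScalarTower.of_algebraMap_eq (fun _ => rfl)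
    haveI : Algebra.IsIntegral (A.map φ) N := by
      refine ⟨fun y => ?_⟩
      have hy : IsIntegral (A.map φ) (y : F) := (hiff y).mp ((hmemN y).mp y.2)
      exact (isIntegral_algHom_iff (IsScalarTower.toAlgHom (A.map φ) N F)
        Subtype.val_injective).mp hy
    have : IsIntegral (A.map φ) x := isIntegral_trans x hx
    exact (hmemN x).mpr ((hiff x).mpr this)
  exact ⟨N, hcarrier, hNfg, hNfr, hNn⟩

end bricks

/-! ### The induction step on the transcendence defect from Thm. 3.3.1 and Steps 3–4 -/

section defectStep

-- one long proof through five fields `k ⊆ k̄ ⊆ K ⊆ L ⊆ L₁` (and `l' ⊆ L`, `m ⊇ l`): the whole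
-- elaboration needs twice the default budget (no single step is expensive)
-- `linter.deprecated` is switched off for the next declaration only (verdict clean-up
-- 2026-08-16): it names, as a hypothesis, the MIS-RENDERED fact `Temkin2013_Steps34`, deprecated
-- in `InseparableLocalUniformizationEngine.lean` in favour of the PROVED corrected rendering
-- `Temkin2013_Steps34_tower` / `Temkin2013_Steps34_tower_holds`; kept for its legacy users (see
-- the module docstring, STATUS, for the unconditional counterparts).
set_option linter.deprecated false in
set_option maxHeartbeats 400000 in
/-- **Steps 0–2 of the proof of Thm. 4.1.1, and the induction step assembled** (Temkin 2013,
proof of Thm. 4.1.1, pp. 47–48: Step 0 "we assume that `D = D_{K/k} > 0` and the theorem is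
proved for smaller `D`'s. … we can replace the field `K` with a finite purely inseparable
extension and update `X` and `Kᵢ`'s accordingly"; Step 1 "Fiber `X` by curves and apply Theorem
3.3.1. Since `D_{K/k} > 0`, it follows from Remark 2.1.2 that there exists a valued subfield
`k̄ ↪ K` containing `k` and such that `tr.deg._{k̄}(K) = 1` and `K/k̄` is transcendentally
immediate; in particular, `D_{k̄/k} = D - 1`. … consider `C = Nr_K(X ×_Y S)` … Theorem 3.3.1
applies to `C`, `Kᵢ/K` and `S`"; Step 2 "Refine `X` and `Y` and extend `K` so that … `f_C` is
an identity and `l = k̄`. Since `C′ = Spec(A)` where `A` is the normalization of a subring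
`k̄°[f₁, …, f_n] ⊂ K°`, we can use `fᵢ`'s to define an affine refinement `X′ → X` such that
`C′ = Nr_K(X′ ×_Y S)`. … Next, we extend the field `K` by replacing it with `L := lK`. Then `X`
is replaced with `X_L := Nr_L(X)`, and we can just replace `Y` and `C` with `Y_l := Nr_l(Y)` and
`Nr_L(X_l ×_{Y_l} S_l) →~ Nr_L(C)`"; Steps 3–4 are the named fact `Temkin2013_Steps34`, whose
hypothesis "Thm. 4.1.1 applies to `Y`" is the induction hypothesis at `(l, l°)`,
`D_{l/k} = D_{k̄/k} = D - 1`). PROVED from the named facts `Temkin2013RelativeCurve`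
(Thm. 3.3.1, `n = 1`) and `Temkin2013_Steps34`; see the module docstring for the dictionary.
[cite: Temkin2013, proof of Thm. 4.1.1, Steps 0–4 (arXiv:0804.1554v3 pp. 47–50)] -/
theorem Temkin2013DescentDefectStep.of_relativeCurve_of_steps34
    (h331 : Temkin2013RelativeCurve.{u}) (h34 : Temkin2013_Steps34.{u}) :
    Temkin2013DescentDefectStep.{u} := by
  intro d ih k K _ _ _ hfg O hk hdim hD A hAO hAfg hAfr hAn K₁ _ _ hfin₁ O₁ hO₁
  classical
  -- Step 0: the easy cases `D ≤ d` (induction hypothesis) and height `0`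
  by_cases hDle : transcendenceDefect k O hk ≤ d
  · exact ih k K hfg O hk hdim hDle A hAO hAfg hAfr hAn K₁ hfin₁ O₁ hO₁
  by_cases htop : O = ⊤
  · subst htop
    exact temkin2013DescentFor_top k K hfg A hAO hAfg hAfr hAn K₁ hfin₁ O₁ hO₁
  change Temkin2013DescentConclusion k K O A K₁ O₁
  haveI := hfin₁
  have hDpos : 0 < transcendenceDefect k O hk := by omega
  have hdim1 : ringKrullDim O = 1 := le_antisymm hdim (one_le_ringKrullDim_of_ne_top O htop)
  have hNK : Algebra.trdeg k K < ℵ₀ := trdeg_lt_aleph0_of_fg hfg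
  ------------------------------------------------------------------
  -- Step 1: the fibration `k̄ ⊆ K` and its valuation ring `k̄°`
  ------------------------------------------------------------------
  obtain ⟨kb, hkbfg, htr1, himm, hDkb, -, -, hNkb⟩ :=
    exists_intermediateField_trdeg_eq_one_isTranscendentallyImmediateOver k O hk hfg hDpos
  set Ob : ValuationSubring kb := O.comap (algebraMap kb K) with hObdef
  have hkOb : ∀ c : k, algebraMap k kb c ∈ Ob := algebraMap_mem_comap hk kb
  have hmemOb : ∀ y : kb, y ∈ Ob ↔ (y : K) ∈ O := fun y => Iff.rfl
  have hDkb' : transcendenceDefect k Ob hkOb + 1 = transcendenceDefect k O hk := hDkb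
  have hDOb : transcendenceDefect k Ob hkOb = d := by omega
  have hkbfg' : (⊤ : IntermediateField k kb).FG :=
    IntermediateField.fg_top_iff.mpr (IntermediateField.essFiniteType_iff.mpr hkbfg)
  have hfgkbK : (⊤ : IntermediateField kb K).FG := by
    haveI : Algebra.EssFiniteType k K := IntermediateField.fg_top_iff.mp hfg
    haveI : Algebra.EssFiniteType kb K := Algebra.EssFiniteType.of_comp k kb K
    exact IntermediateField.fg_top_iff.mpr ‹_›
  have hNkb' : Algebra.trdeg k kb < ℵ₀ :=
    calc Algebra.trdeg k kb ≤ Algebra.trdeg k kb + 1 := self_le_add_right _ _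
      _ = Algebra.trdeg k K := hNkb
      _ < ℵ₀ := hNK
  have hvt : IsValueTorsionOver O (algebraMap kb K).fieldRange ⊤ := by
    rw [fieldRange_algebraMap_eq_toSubfield]; exact himm.1
  have hra : IsResiduallyAlgebraicOver O (algebraMap kb K).fieldRange ⊤ := by
    rw [fieldRange_algebraMap_eq_toSubfield]; exact himm.2
  have hdimOb : ringKrullDim Ob = 1 :=
    ringKrullDim_comap_eq_one_of_isValueTorsionOver O hdim htop (algebraMap kb K) hvt
  have hchar : ringChar (ResidueField Ob) = ringChar kb :=
    ringChar_residueField_eq_of_algebraMap_mem Ob hkOb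
  -- the curve `C = Nr_K(X ×_Y S)` over `S = Spec k̄°`
  obtain ⟨t, ht⟩ := id hAfg
  have htA : (t : Set K) ⊆ A := by rw [← ht]; exact Algebra.subset_adjoin
  set XS : Subring K := etaModel kb (nrIn A.toSubring) Ob.toSubring with hXSdef
  have hXSmodel₀ : IsAffineNormalizedModel ⊤ (Ob.toSubring.map (algebraMap kb K)) XS :=
    isAffineNormalizedModel_etaModel A t ht hAfr Ob.toSubring hkOb
  have hXSO : XS ≤ O.toSubring :=
    etaModel_le_valuationSubring A O hAO Ob.toSubring (fun c hc => hc)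
  have hXSmodel : IsAffineNormalizedModel O (Ob.toSubring.map (algebraMap kb K)) XS :=
    hXSmodel₀.of_le hXSO
  have hAXS : A.toSubring ≤ XS := (le_nrIn A.toSubring).trans (le_etaModel _ _)
  have hObO : Ob.toSubring.map (algebraMap kb K) ≤ O.toSubring := by
    rintro _ ⟨y, hy, rfl⟩; exact hy
  ------------------------------------------------------------------
  -- Theorem 3.3.1 for `C`, `K₁/K` and `S`
  ------------------------------------------------------------------
  obtain ⟨A', hXSA', hA'model, L₁, instFL₁, instK₁L₁, instKL₁, instkbL₁, towKK₁L₁, towkbKL₁,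
    hfinL₁, hpiL₁, l, hlfin, hlpi, hK₁l, O₁', hO₁', m, instFm, instlm, instkbm, towkblm, hmfin, -,
    Om, hOm, N, hN, hNint, hkN, hkm, hSE⟩ :=
    h331 kb K Ob O hchar rfl hdimOb hdim1 hfgkbK htr1 hvt hra XS hXSmodel K₁ hfin₁ O₁ hO₁
  -- normalise the `k̄`-structure of `L₁` given by Thm. 3.3.1 to the restriction of its
  -- `K`-structure (they agree: `IsScalarTower k̄ K L₁`), so that no instance diamond arises
  have hinst : instkbL₁ = IntermediateField.instAlgebraSubtypeMem kb :=
    Algebra.algebra_ext _ _ fun c => IsScalarTower.algebraMap_apply kb K L₁ c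
  subst hinst
  haveI := hfinL₁
  haveI := hpiL₁
  haveI := hlfin
  haveI := hlpi
  haveI := hmfin
  obtain ⟨hA'O, hObA''⟩ := hA'model.le_and_le hObO
  have hObA' : ∀ y : kb, y ∈ Ob → (y : K) ∈ A' := fun y hy => hObA'' ⟨y, hy, rfl⟩
  obtain ⟨s, hsO, hA'set, -⟩ := hA'model
  obtain ⟨C₀, hC₀⟩ : ∃ C₀ : Subring K,
      C₀ = Subring.closure (↑(Ob.toSubring.map (algebraMap kb K)) ∪ (s : Set K)) := ⟨_, rfl⟩
  have hA'C₀ : A' = nrIn C₀ := by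
    apply SetLike.coe_injective
    rw [hA'set, hC₀]
    rfl
  have hsA' : (s : Set K) ⊆ A' := fun y hy => by
    rw [hA'C₀]
    exact le_nrIn C₀ (by rw [hC₀]; exact Subring.subset_closure (Or.inr hy))
  -- `k`-structure on `L₁` through `K`, and the towers
  letI instkL₁ : Algebra k L₁ := ((algebraMap K L₁).comp (algebraMap k K)).toAlgebra
  haveI : IsScalarTower k K L₁ := IsScalarTower.of_algebraMap_eq fun _ => rfl
  haveI : IsScalarTower k kb L₁ := IsScalarTower.of_algebraMap_eq fun c => by
    show (algebraMap K L₁) (algebraMap k K c) = algebraMap kb L₁ (algebraMap k kb c)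
    rw [IsScalarTower.algebraMap_apply kb K L₁, ← IsScalarTower.algebraMap_apply k kb K]
  haveI : FiniteDimensional K L₁ := Module.Finite.trans K₁ L₁
  haveI : Algebra.IsAlgebraic K L₁ := Algebra.IsAlgebraic.of_finite K L₁
  have hO₁'K : O₁'.comap (algebraMap K L₁) = O := by
    rw [IsScalarTower.algebraMap_eq K K₁ L₁, ← ValuationSubring.comap_comap, hO₁', hO₁]
  -- exponential characteristic
  obtain ⟨q, hq⟩ := ExpChar.exists k
  haveI := hq
  haveI hqkb : ExpChar kb q := expChar_of_injective_algebraMap (algebraMap k kb).injective q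
  haveI hqK : ExpChar K q := expChar_of_injective_algebraMap (algebraMap k K).injective q
  ------------------------------------------------------------------
  -- Step 2: `L = K(l) ⊆ L₁`, its valuation ring, and the copy `l'` of `l` inside `L`
  ------------------------------------------------------------------
  set Lad : IntermediateField K L₁ := IntermediateField.adjoin K (l : Set L₁) with hLaddef
  have hlLad : (l : Set L₁) ⊆ (Lad : Set L₁) := IntermediateField.subset_adjoin K _
  haveI hLadpi : IsPurelyInseparable K Lad := by
    rw [hLaddef, IntermediateField.isPurelyInseparable_adjoin_iff_pow_mem K L₁ q]
    intro x hx
    obtain ⟨n, y, hy⟩ := IsPurelyInseparable.pow_mem kb q (⟨x, hx⟩ : l)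
    have hy' : algebraMap kb L₁ y = x ^ q ^ n := by
      have := congrArg (algebraMap l L₁) hy
      rw [← IsScalarTower.algebraMap_apply kb l L₁, map_pow] at this
      exact this
    exact ⟨n, algebraMap kb K y, by rw [← IsScalarTower.algebraMap_apply kb K L₁]; exact hy'⟩
  haveI : IsScalarTower k Lad L₁ := IsScalarTower.of_algebraMap_eq fun _ => rfl
  haveI : FiniteDimensional Lad L₁ := Module.Finite.of_restrictScalars_finite K Lad L₁
  set OL : ValuationSubring Lad := O₁'.comap (algebraMap Lad L₁) with hOLdef
  have hmemOL : ∀ x : Lad, x ∈ OL ↔ (x : L₁) ∈ O₁' := fun x => Iff.rfl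
  have hOLK : OL.comap (algebraMap K Lad) = O := by
    rw [hOLdef, ValuationSubring.comap_comap, ← IsScalarTower.algebraMap_eq K Lad L₁, hO₁'K]
  have hkOL : ∀ c : k, algebraMap k Lad c ∈ OL := fun c => by
    have h1 : algebraMap k K c ∈ OL.comap (algebraMap K Lad) := by rw [hOLK]; exact hk c
    have h2 : algebraMap K Lad (algebraMap k K c) ∈ OL := h1
    rwa [← IsScalarTower.algebraMap_apply k K Lad] at h2
  have hfgL : (⊤ : IntermediateField k Lad).FG :=
    intermediateField_fg_top_of_finiteDimensional (F := K) hfg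
  -- the copy `l'` of `l` inside `L`
  let ι : Lad →ₐ[k] L₁ := IsScalarTower.toAlgHom k Lad L₁
  let l' : IntermediateField k Lad := (l.restrictScalars k).comap ι
  have hmeml' : ∀ x : Lad, x ∈ l' ↔ (x : L₁) ∈ l := fun x => Iff.rfl
  have hkbl' : ∀ c : kb, ((algebraMap K Lad).comp (algebraMap kb K)) c ∈ l' := fun c => by
    rw [hmeml']
    have : algebraMap kb L₁ c ∈ l := l.algebraMap_mem c
    rw [IsScalarTower.algebraMap_apply kb K L₁] at this
    exact this
  let algKbl' : kb →+* l' := ((algebraMap K Lad).comp (algebraMap kb K)).codRestrict l' hkbl'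
  letI instkbl' : Algebra kb l' := algKbl'.toAlgebra
  -- shortcut instances (instance synthesis through the subtype towers is slow)
  letI : Module kb l' := Algebra.toModule
  letI : SMul kb l' := Algebra.toSMul
  have halgkbl' : ∀ y : kb, (((algebraMap kb l' y : l') : Lad) : L₁) = algebraMap kb L₁ y :=
    fun _ => rfl
  haveI : IsScalarTower k kb l' := IsScalarTower.of_algebraMap_eq fun c => by
    apply Subtype.ext
    apply Subtype.ext
    show algebraMap k L₁ c = algebraMap K L₁ ((algebraMap k kb c : kb) : K)
    rfl
  -- the identification `e : l' ≅ l`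
  let e : l' →+* l :=
    { toFun := fun x => ⟨((x : Lad) : L₁), (hmeml' x).mp x.2⟩
      map_one' := rfl
      map_mul' := fun _ _ => rfl
      map_zero' := rfl
      map_add' := fun _ _ => rfl }
  have he : ∀ x : l', (e x : L₁) = ((x : Lad) : L₁) := fun _ => rfl
  have he_surj : Function.Surjective e := fun z =>
    ⟨⟨⟨(z : L₁), hlLad z.2⟩, (hmeml' _).mpr z.2⟩, Subtype.ext rfl⟩
  have he_inj : Function.Injective e := fun x y hxy =>
    Subtype.ext (Subtype.ext (congrArg (fun z : l => (z : L₁)) hxy))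
  have he_alg : ∀ y : kb, e (algebraMap kb l' y) = algebraMap kb l y := fun y =>
    Subtype.ext (by rw [he, halgkbl']; rfl)
  haveI hfdl' : FiniteDimensional kb l' := by
    let f : l' →ₗ[kb] l :=
      { toFun := e
        map_add' := fun x y => map_add e x y
        map_smul' := fun c x => by
          rw [RingHom.id_apply, Algebra.smul_def, Algebra.smul_def, map_mul, he_alg] }
    exact FiniteDimensional.of_injective f he_inj
  haveI : Algebra.IsAlgebraic kb l' := Algebra.IsAlgebraic.of_finite kb l'
  haveI hl'pi : IsPurelyInseparable kb l' := by
    rw [isPurelyInseparable_iff_pow_mem kb q]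
    intro x
    obtain ⟨n, y, hy⟩ := IsPurelyInseparable.pow_mem kb q (e x)
    refine ⟨n, y, he_inj ?_⟩
    rw [he_alg, map_pow]
    exact hy
  have hl'fg : (⊤ : IntermediateField k l').FG :=
    intermediateField_fg_top_of_finiteDimensional (F := kb) hkbfg'
  -- the valuation ring `l'° = L° ∩ l'`
  set Ol' : ValuationSubring l' := OL.comap (algebraMap l' Lad) with hOl'def
  have hmemOl' : ∀ x : l', x ∈ Ol' ↔ ((x : Lad) : L₁) ∈ O₁' := fun x => Iff.rfl
  have hOl'kb : Ol'.comap (algebraMap kb l') = Ob := by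
    ext y
    show algebraMap K L₁ (algebraMap kb K y) ∈ O₁' ↔ (y : K) ∈ O
    rw [← hO₁'K]
    rfl
  have hkOl' : ∀ c : k, algebraMap k l' c ∈ Ol' := fun c => hkOL c
  have hdiml' : ringKrullDim Ol' = 1 := by
    rw [ringKrullDim_eq_comap_of_isPurelyInseparable (K := kb) Ol', hOl'kb, hdimOb]
  have hDl' : transcendenceDefect k Ol' hkOl' ≤ d := by
    have h := transcendenceDefect_le_of_isAlgebraic (F := kb) Ol' Ob hOl'kb hkOl' hkOb hNkb'
    rwa [hDOb] at h
  -- "the induction assumption applies to the scheme `Y`" (for `l'`, `l'°`)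
  have hDY : Temkin2013DescentFor k l' Ol' := ih k l' hl'fg Ol' hkOl' hdiml'.le hDl'
  -- `qⁿ`-th powers of elements of `l'` lie in `k̄`
  have hpow : ∀ x : l', ∃ n : ℕ, ∃ y : kb, algebraMap kb l' y = x ^ q ^ n := fun x => by
    obtain ⟨n, y, hy⟩ := IsPurelyInseparable.pow_mem kb q x
    exact ⟨n, y, hy⟩
  choose nn yy hyy using hpow
  have hyyOb : ∀ x : l', x ∈ Ol' → yy x ∈ Ob := fun x hx => by
    have h1 : algebraMap kb l' (yy x) ∈ Ol' := by rw [hyy]; exact pow_mem hx _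
    have h2 : yy x ∈ Ol'.comap (algebraMap kb l') := h1
    rwa [hOl'kb] at h2
  have hyyL₁ : ∀ x : l', ((x : Lad) : L₁) ^ q ^ nn x = algebraMap kb L₁ (yy x) := fun x => by
    have h := congrArg ((algebraMap Lad L₁).comp (algebraMap l' Lad)) (hyy x)
    rw [map_pow] at h
    exact h.symm
  ------------------------------------------------------------------
  -- Step 2a: an affine model `B'` of `l'°` and the refinement `X″ = Nr_K(A[f, c])` of `X`
  ------------------------------------------------------------------
  obtain ⟨B', hB'O, hB'fg, hB'fr⟩ := exists_affineModel k l' hl'fg Ol' hkOl'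
  obtain ⟨b', hb'⟩ := id hB'fg
  have hb'B' : (b' : Set l') ⊆ B' := by rw [← hb']; exact Algebra.subset_adjoin
  set cset : Finset K := b'.image fun x : l' => ((yy x : kb) : K) with hcset
  have hcmem : ∀ y : K, y ∈ cset → ∃ x : l', x ∈ b' ∧ ((yy x : kb) : K) = y := fun y hy => by
    simpa [hcset, Finset.mem_image] using hy
  have hcO : (cset : Set K) ⊆ (O : Set K) := fun y hy => by
    obtain ⟨x, hx, rfl⟩ := hcmem y hy
    exact (hmemOb _).mp (hyyOb x (hB'O (hb'B' hx)))
  have hcA' : (cset : Set K) ⊆ A' := fun y hy => by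
    obtain ⟨x, hx, rfl⟩ := hcmem y hy
    exact hObA' _ (hyyOb x (hB'O (hb'B' hx)))
  set A₁ : Subalgebra k K := Algebra.adjoin k (↑t ∪ ↑s ∪ ↑cset) with hA₁def
  have hAA₁ : A ≤ A₁ := by
    rw [← ht]
    exact Algebra.adjoin_mono fun y hy => Or.inl (Or.inl hy)
  have hA₁fg : A₁.FG := ⟨t ∪ s ∪ cset, by rw [Finset.coe_union, Finset.coe_union]⟩
  let Oalg : Subalgebra k K := { O.toSubring.toSubsemiring with algebraMap_mem' := hk }
  have hA₁O : A₁.toSubring ≤ O.toSubring := by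
    have : A₁ ≤ Oalg := Algebra.adjoin_le (Set.union_subset (Set.union_subset (htA.trans hAO)
      hsO) hcO)
    exact fun y hy => this hy
  have hA₁fr : IsFractionRing A₁ K := by
    haveI := hAfr
    refine IsFractionRing.of_field A₁ K fun z => ?_
    obtain ⟨a, b, -, rfl⟩ := IsFractionRing.div_surjective (A := A) z
    exact ⟨⟨a, hAA₁ a.2⟩, ⟨b, hAA₁ b.2⟩, rfl⟩
  obtain ⟨A₂, hA₁A₂, hA₂O, hA₂fg, hA₂fr, hA₂n, hA₂set⟩ :=
    exists_normal_affineModel_ge' O A₁ hA₁O hA₁fg hA₁fr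
  have hAA₂ : A ≤ A₂ := hAA₁.trans hA₁A₂
  have hA₁A' : A₁.toSubring ≤ A' := by
    intro y hy
    have hy' : y ∈ (Algebra.adjoin k (↑t ∪ ↑s ∪ ↑cset : Set K)).toSubring := hy
    rw [Algebra.adjoin_eq_ring_closure] at hy'
    refine (Subring.closure_le.mpr ?_) hy'
    rintro z (⟨c, rfl⟩ | ((hz | hz) | hz))
    · exact hObA' _ (hkOb c)
    · exact hXSA' (hAXS (htA hz))
    · exact hsA' hz
    · exact hcA' hz
  have hA₂A' : A₂.toSubring ≤ A' := fun x hx => by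
    have hx' : IsIntegral A₁ x := by
      have hx2 : x ∈ (A₂ : Set K) := hx
      rw [hA₂set] at hx2
      exact hx2
    have h1 : x ∈ nrIn A₁.toSubring := hx'
    have h2 : x ∈ nrIn A' := nrIn_mono hA₁A' h1
    rw [hA'C₀, nrIn_nrIn] at h2
    rw [hA'C₀]
    exact h2
  ------------------------------------------------------------------
  -- Step 2b: `A_L = Nr_L(X″)`, a normal affine model of `L°` containing `B'`
  ------------------------------------------------------------------
  obtain ⟨AL, hALset, hALfg, hALfr, hALn⟩ := exists_normalisation_in_extension A₂ hA₂fg hA₂fr Lad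
  have hmemAL : ∀ x : Lad, x ∈ AL ↔ IsIntegral (A₂.map (IsScalarTower.toAlgHom k K Lad)) x :=
    fun x => by rw [← SetLike.mem_coe, hALset]; rfl
  have hA₂AL : ∀ a ∈ A₂, algebraMap K Lad a ∈ AL := fun a ha => by
    rw [hmemAL]
    exact isIntegral_algebraMap
      (x := (⟨_, Subalgebra.mem_map.mpr ⟨a, ha, rfl⟩⟩ : A₂.map (IsScalarTower.toAlgHom k K Lad)))
  have hA₂OL : ∀ a ∈ A₂, algebraMap K Lad a ∈ OL := fun a ha => by
    have : a ∈ OL.comap (algebraMap K Lad) := by rw [hOLK]; exact hA₂O ha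
    exact this
  have hALO : AL.toSubring ≤ OL.toSubring := fun x hx => by
    have hx' := (hmemAL x).mp hx
    refine mem_valuationSubring_of_isIntegral OL (A₂.map (IsScalarTower.toAlgHom k K Lad)) ?_ hx'
    rintro _ ⟨a, ha, rfl⟩
    exact hA₂OL a ha
  have hB'AL : ∀ b : B', algebraMap l' Lad b ∈ AL := by
    have hle : B'.map (IsScalarTower.toAlgHom k l' Lad) ≤ AL := by
      rw [← hb', AlgHom.map_adjoin]
      refine Algebra.adjoin_le ?_
      rintro _ ⟨x, hx, rfl⟩
      rw [SetLike.mem_coe, hmemAL]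
      show IsIntegral _ (x : Lad)
      refine IsIntegral.of_pow (expChar_pow_pos kb q (nn x)) ?_
      have hx1 : (x : Lad) ^ q ^ nn x = algebraMap K Lad ((yy x : kb) : K) := by
        apply Subtype.ext
        rw [SubmonoidClass.coe_pow, hyyL₁ x, IsScalarTower.algebraMap_apply kb K L₁]
        rfl
      rw [hx1]
      have hmem : ((yy x : kb) : K) ∈ A₂ :=
        hA₁A₂ (Algebra.subset_adjoin (Or.inr (Finset.mem_coe.mpr
          (Finset.mem_image.mpr ⟨x, hx, rfl⟩))))
      exact hA₂AL _ hmem |> fun h => (hmemAL _).mp h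
    intro b
    exact hle (Subalgebra.mem_map.mpr ⟨b, b.2, rfl⟩)
  ------------------------------------------------------------------
  -- the identification `Nr_{L₁}(A_L · l'°) = N = Nr_{L₁}(C')`
  ------------------------------------------------------------------
  have hNeq : N = nrIn (A'.map (algebraMap K L₁)) := SetLike.coe_injective (by rw [hNint]; rfl)
  have hNn : nrIn N = N := by rw [hNeq, nrIn_nrIn]
  have hA'N : A'.map (algebraMap K L₁) ≤ N := by rw [hNeq]; exact le_nrIn _
  have hObN : ∀ y : kb, y ∈ Ob → algebraMap kb L₁ y ∈ N := fun y hy => by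
    rw [IsScalarTower.algebraMap_apply kb K L₁]
    exact hA'N ⟨(y : K), hObA' y hy, rfl⟩
  have hOl'N : ∀ x : l', x ∈ Ol' → ((x : Lad) : L₁) ∈ N := fun x hx => by
    rw [← hNn, mem_nrIn_iff]
    refine IsIntegral.of_pow (expChar_pow_pos kb q (nn x)) ?_
    rw [hyyL₁ x]
    exact isIntegral_algebraMap (R := N) (x := ⟨_, hObN (yy x) (hyyOb x hx)⟩)
  have hA₂N : ∀ a ∈ A₂, algebraMap K L₁ a ∈ N := fun a ha => hA'N ⟨a, hA₂A' ha, rfl⟩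
  have hALN : ∀ x : Lad, x ∈ AL → (x : L₁) ∈ N := fun x hx => by
    have hx' := (hmemAL x).mp hx
    rw [← hNn, mem_nrIn_iff]
    have hmaple : (A₂.map (IsScalarTower.toAlgHom k K Lad)).toSubring.map (algebraMap Lad L₁) ≤
        N := by
      rintro _ ⟨z, hz, rfl⟩
      obtain ⟨a, ha, rfl⟩ := Subalgebra.mem_map.mp (show z ∈ A₂.map _ from hz)
      exact hA₂N a ha
    exact isIntegral_map_of_map_le (algebraMap Lad L₁) hmaple hx'
  set T₁ : Subring L₁ := nrIn (AL.toSubring.map (algebraMap Lad L₁)) ⊔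
    Ol'.toSubring.map (algebraMap l' L₁) with hT₁def
  have hT₁N : T₁ ≤ N := by
    refine sup_le ?_ ?_
    · have h1 : AL.toSubring.map (algebraMap Lad L₁) ≤ N := by
        rintro _ ⟨x, hx, rfl⟩; exact hALN x hx
      exact (nrIn_mono h1).trans (le_of_eq hNn)
    · rintro _ ⟨x, hx, rfl⟩; exact hOl'N x hx
  have hC₀T₁ : C₀.map (algebraMap K L₁) ≤ T₁ := by
    rw [Subring.map_le_iff_le_comap, hC₀, Subring.closure_le]
    rintro y (⟨z, hz, rfl⟩ | hy)
    · refine (le_sup_right : _ ≤ T₁) ⟨algebraMap kb l' z, ?_, ?_⟩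
      · show algebraMap kb l' z ∈ Ol'
        have : z ∈ Ol'.comap (algebraMap kb l') := by rw [hOl'kb]; exact hz
        exact this
      · show (((algebraMap kb l' z : l') : Lad) : L₁) = algebraMap K L₁ (algebraMap kb K z)
        rfl
    · refine (le_sup_left : _ ≤ T₁) (le_nrIn _ ⟨algebraMap K Lad y, ?_, rfl⟩)
      exact hA₂AL y (hA₁A₂ (Algebra.subset_adjoin (Or.inl (Or.inr hy))))
  have hkey : etaModel l' (nrIn (AL.toSubring.map (algebraMap Lad L₁))) Ol'.toSubring = N := by
    apply le_antisymm
    · calc etaModel l' (nrIn (AL.toSubring.map (algebraMap Lad L₁))) Ol'.toSubring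
          = nrIn T₁ := rfl
        _ ≤ nrIn N := nrIn_mono hT₁N
        _ = N := hNn
    · have h1 : A'.map (algebraMap K L₁) ≤ nrIn T₁ := by
        rintro _ ⟨x, hx, rfl⟩
        have hx' : IsIntegral C₀ x := by
          rw [hA'C₀] at hx
          exact hx
        exact isIntegral_map_of_map_le (algebraMap K L₁) hC₀T₁ hx'
      have h2 := nrIn_mono h1
      rw [nrIn_nrIn, ← hNeq] at h2
      exact h2
  have hXS₂ : etaModel l' (nrIn (AL.toSubring.map (algebraMap Lad L₁))) Ol'.toSubring ≤
      O₁'.toSubring := by rw [hkey]; exact hN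
  ------------------------------------------------------------------
  -- `m` as an `l'`-algebra
  ------------------------------------------------------------------
  letI instl'l : Algebra l' l := e.toAlgebra
  letI instl'm : Algebra l' m := ((algebraMap l m).comp e).toAlgebra
  letI : Module l' l := Algebra.toModule
  letI : SMul l' l := Algebra.toSMul
  letI : Module l' m := Algebra.toModule
  letI : SMul l' m := Algebra.toSMul
  haveI : IsScalarTower l' l m := IsScalarTower.of_algebraMap_eq fun _ => rfl
  haveI : Module.Finite l' l :=
    Module.Finite.of_surjective (Algebra.linearMap l' l) he_surj
  haveI : FiniteDimensional l' m := Module.Finite.trans l m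
  have hOm' : Om.comap (algebraMap l' m) = Ol' := by
    ext x
    have h1 : e x ∈ Om.comap (algebraMap l m) ↔ e x ∈ O₁'.comap (algebraMap l L₁) := by rw [hOm]
    exact h1
  have hOm₂ : ∀ c : Ol'.toSubring, algebraMap l' m c ∈ Om := fun c => by
    have : (c : l') ∈ Om.comap (algebraMap l' m) := by rw [hOm']; exact c.2
    exact this
  ------------------------------------------------------------------
  -- the smooth-equivalence of Thm. 3.3.1, over `l'°` and for the model `A_L`
  ------------------------------------------------------------------
  have hOl'N' : ∀ c : Ol'.toSubring, ((algebraMap l' L₁).comp Ol'.toSubring.subtype) c ∈ N :=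
    fun c => hOl'N c c.2
  have hSE₂ : AreSmoothEquivalent
      (etaModelBaseMap (nrIn (AL.toSubring.map (algebraMap Lad L₁))) Ol'.toSubring)
      (((algebraMap l' m).comp Ol'.toSubring.subtype).codRestrict Om hOm₂)
      ((maximalIdeal O₁').comap (Subring.inclusion hXS₂)) (maximalIdeal Om) := by
    rw [areSmoothEquivalent_congr_of_eq O₁' hkey hXS₂ hN
      (etaModelBaseMap (nrIn (AL.toSubring.map (algebraMap Lad L₁))) Ol'.toSubring)
      (((algebraMap l' L₁).comp Ol'.toSubring.subtype).codRestrict N hOl'N') (fun _ => rfl)]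
    -- base change from `k̄°` to `l'°`
    have hObOl' : ∀ y : Ob, (algKbl'.comp Ob.subtype) y ∈ Ol'.toSubring := fun y => by
      show algebraMap kb l' (y : kb) ∈ Ol'
      have : (y : kb) ∈ Ol'.comap (algebraMap kb l') := by rw [hOl'kb]; exact y.2
      exact this
    let φ : Ob →+* Ol'.toSubring := (algKbl'.comp Ob.subtype).codRestrict Ol'.toSubring hObOl'
    have hφ : ∀ x : Ol'.toSubring, ∃ n : ℕ, x ^ q ^ n ∈ φ.range := fun x =>
      ⟨nn x, ⟨yy x, hyyOb x x.2⟩, Subtype.ext (by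
        rw [SubmonoidClass.coe_pow]
        exact hyy x)⟩
    let iN : k →+* N := ((algebraMap kb L₁).comp (algebraMap k kb)).codRestrict N
      fun c => hkN ⟨algebraMap k kb c, hkOb c⟩
    refine AreSmoothEquivalent.of_comp_of_forall_pow_mem q iN φ hφ _ _ ?_
    have hf : (((algebraMap l' L₁).comp Ol'.toSubring.subtype).codRestrict N hOl'N').comp φ =
        ((algebraMap kb L₁).comp Ob.subtype).codRestrict N hkN :=
      RingHom.ext fun y => Subtype.ext (halgkbl' y)
    have hg : (((algebraMap l' m).comp Ol'.toSubring.subtype).codRestrict Om hOm₂).comp φ =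
        ((algebraMap kb m).comp Ob.subtype).codRestrict Om hkm :=
      RingHom.ext fun y => Subtype.ext (by
        show algebraMap l m (e (algebraMap kb l' y)) = algebraMap kb m y
        rw [he_alg, ← IsScalarTower.algebraMap_apply kb l m])
    rw [hf, hg]
    exact hSE
  ------------------------------------------------------------------
  -- Steps 3–4 (`Temkin2013_Steps34`) for `(k, L, L°, l', B', A_L, L₁, L₁°, m, m°)`
  ------------------------------------------------------------------
  have hOLcomap : O₁'.comap (algebraMap Lad L₁) = OL := rfl
  have hconclL : Temkin2013DescentConclusion k Lad OL AL L₁ O₁' :=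
    h34 k Lad hfgL OL hkOL l' hl'fg hdiml'.le hDY B' hB'O hB'fg hB'fr AL hALO hALfg hALfr hALn
      hB'AL L₁ inferInstance O₁' hOLcomap m inferInstance Om hOm' hXS₂ hOm₂ hSE₂
  ------------------------------------------------------------------
  -- Step 0: back to `K`, `X″` and `K₁`, then to `X`
  ------------------------------------------------------------------
  have hgen : Algebra.adjoin K₁ (Set.range (algebraMap Lad L₁)) = ⊤ := by
    rw [eq_top_iff, ← hK₁l]
    refine Algebra.adjoin_mono ?_
    intro x hx
    exact ⟨⟨x, hlLad hx⟩, rfl⟩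
  have hconclK : Temkin2013DescentConclusion k K O A₂ K₁ O₁ :=
    Temkin2013DescentConclusion.of_purelyInseparable O A₂ hA₂fg hA₂fr Lad OL hOLK AL hA₂AL K₁ O₁
      L₁ hgen O₁' hO₁' hconclL
  exact Temkin2013DescentConclusion.of_le O hAA₂ hconclK

end defectStep

/-! ### Corollaries: the frontier of Thm. 1.3.2 after this file -/

-- `linter.deprecated` off for the next declaration only (same reason: its hypothesis is the
-- deprecated `Temkin2013_Steps34`; see the first such switch in this file).
set_option linter.deprecated false in
/-- **Thm. 4.1.1 (`n = 1`, non-logarithmic form)** from the Abhyankar case (Step 0 ⇐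
Thm. 5.5.2), Thm. 3.3.1 and Steps 3–4. [cite: Temkin2013, Thm. 4.1.1, proof (pp. 47–50)] -/
theorem Temkin2013Descent.of_relativeCurve_of_steps34 (h0 : Temkin2013DescentAbhyankar.{u})
    (h331 : Temkin2013RelativeCurve.{u}) (h34 : Temkin2013_Steps34.{u}) :
    Temkin2013Descent.{u} :=
  Temkin2013Descent.of_defect h0 (Temkin2013DescentDefectStep.of_relativeCurve_of_steps34 h331 h34)

-- `linter.deprecated` off for the next declaration only (same reason: its hypothesis is the
-- deprecated `Temkin2013_Steps34`; see the first such switch in this file).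
set_option linter.deprecated false in
/-- The corrected relative Thm. 1.3.2 from the frontier `{Temkin2013DescentAbhyankar,
Temkin2013RelativeCurve, Temkin2013_Steps34, Temkin2013HeightStepOfDescent}`.
[cite: Temkin2013, Section 4] -/
theorem Temkin2013Relative.of_curve_frontier (h0 : Temkin2013DescentAbhyankar.{u})
    (h331 : Temkin2013RelativeCurve.{u}) (h34 : Temkin2013_Steps34.{u})
    (hh : Temkin2013HeightStepOfDescent.{u}) : Temkin2013Relative.{u} :=
  Temkin2013Relative.of_defect_frontier h0
    (Temkin2013DescentDefectStep.of_relativeCurve_of_steps34 h331 h34) hh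

-- `linter.deprecated` off for the next declaration only (same reason: its hypothesis is the
-- deprecated `Temkin2013_Steps34`; see the first such switch in this file).
set_option linter.deprecated false in
/-- … and the weak absolute form `Temkin2013` used by the routes.
[cite: Temkin2013, Thm. 1.3.2] -/
theorem Temkin2013.of_curve_frontier (h0 : Temkin2013DescentAbhyankar.{u})
    (h331 : Temkin2013RelativeCurve.{u}) (h34 : Temkin2013_Steps34.{u})
    (hh : Temkin2013HeightStepOfDescent.{u}) : Temkin2013.{u} :=
  Temkin2013.of_defect_frontier h0
    (Temkin2013DescentDefectStep.of_relativeCurve_of_steps34 h331 h34) hh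

-- `linter.deprecated` off for the next declaration only (same reason: its hypothesis is the
-- deprecated `Temkin2013_Steps34`; see the first such switch in this file).
set_option linter.deprecated false in
/-- The height-`≤ 1` case from the same frontier. [folklore] -/
theorem Temkin2013HeightLeOne.of_curve_frontier (h0 : Temkin2013DescentAbhyankar.{u})
    (h331 : Temkin2013RelativeCurve.{u}) (h34 : Temkin2013_Steps34.{u}) :
    Temkin2013HeightLeOne.{u} :=
  Temkin2013HeightLeOne.of_defect_frontier h0
    (Temkin2013DescentDefectStep.of_relativeCurve_of_steps34 h331 h34)

end Literature.AlgebraicGeometry.Resolution
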